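import Summits.QuantumFields.YangMills.Theorems.BalabanUVNodesK2CornerRoadRowsMassBand
import Summits.QuantumFields.YangMills.Theorems.BalabanUVNodesK1V9Defs
import Summits.QuantumFields.YangMills.Theorems.BalabanUVNodesK1RunRowsTextOfN11CUOfRowsWF

/-!
# Route `BalabanUVNodes` rev 29 — THE MASS-BAND CORNER ROAD ON K1 «v9» LINE 2 (hypothesis form; 0 `def`, 0 `sorry`):
# at a world bound to a REVISED record datum (`RecordSⱽ`), U3ᴷ-lite moduli-with-mass + a per-scale anchor + a positive one-loop drift pay the RUN-LETTER BUNDLE of the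
# V-stubs 2ⱽ∘3ⱽ at ANY ceiling above the drift band, hence rung 2ⱽ‴'s text and the deciding crux K1⁹ `StabilityBRunRowsAtRecordR13SepCoPHV` (stmt-QuantumFields-27364) BY NAME

Cell `ym-nodeO-ideate`, PROVER seat `ym-nodeO-port-1` (gen 5).  Eighth file of the corner road; sibling of `…K2CornerRoadRowsMassBand` (p622247: the §1 lever
`constRemainder_of_histLipschitz_massBound_scaleAnchor` and the LINE-1 producers) and `…K2CornerRoadRowsV` (p626226: the slot-keyed K-texts); imports `…K1RunRowsTextOfN11CUOfRowsWF` (the N11-only ceiling raise `nodes_leavesP_reletter_ceiling_all`) and dag-n13-w3 g4's LINE-2 composition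
kernel through DEF-1 g9's by-name mirror `…K1V9Defs` (p628520: `RecordSV`, `NodesAtSomeRecord13PWSV`, `RunRowsAtSomeRecord13PWSV`, `RunRowsContAtSomeRecord13PWSV`, `stub_cont13V_of_cont13All`,
`stabilityBRunRowsAtRecordR13SepCoPHV_of_rung0_runRowsContV` — itself over p627483 `…K1R9BodyAtRevisedRecordWorldOfNodesRunLetters`, the V-END road; all cited, NOT restated).  Helper keyed `--supports stmt-QuantumFields-27364 --as helper` (K1⁹, DECIDING; dag-lead KEY MAP v2,
director-ym №31 (2)); count-neutral; NO skeleton is registered or re-keyed by this file.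

WHY.  Plan g86 registered the UNION skeleton «v9» = LINE 1 ∪ LINE 2 on the K1⁹ item (sha256 e3ea62ca8052a293…, 2026-08-28T11:16:46Z; pub-ymgap INBOX [YMPLAN-G86-K1V9-REGISTERED]).  LINE 2 keys
the rung-1 world at the VERSION SLOT: `RecordSⱽ F θ h v w` = LINE 1's `RecordS` byte-kept except `w.C = (Node00.datumOfRecord₁₃SepCoPHV F 2 θ h v).C`, and its stubs 2ⱽ
(`stub_runRows13PWSV : ∀ F, NodesAtSomeRecord13PWSV F → RunRowsAtSomeRecord13PWSV F`) and 3ⱽ (`stub_cont13V : … → RunRowsContAtSomeRecord13PWSV F`) ask, at a rung-1ⱽ witness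
`(θ, h, v, w)`, the RUN LETTERS of `β_θ := Node00.betaOfRecord₁₃ F 2 θ.toStage13Params` — (i) `RunConstRemainder β_θ b r γ₀`, (ii) `b ≤ B`, (iii) the ceiling match `B + r ≤ w.βup`, (iv) the
run-wise partial-sum floor `−M`, and (C) `SurvCont β_θ γ₀` — θ-level and slot-free (`Node00.βfun_datumOfRecord₁₃SepCoPHV` is `rfl`).  The corner road's LINE-1 producers (p622247 §3) pay exactly
this bundle from U3ᴷ-lite + anchor + positive drift at any ceiling above the drift band `s + 2A`; this file re-keys them at the slot: the letters are UNCHANGED (they never read the world's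
construction `w.C`), only the world class in the ∃-tuples becomes `RecordSⱽ` and the by-name door becomes dag-n13-w3's V-END road (the slot is the witness's OWN `v`, not `Revision₁₃.refl`).

CONTENTS.  §1 (generic `β : HBeta`, slot-free) ★ `runLettersAtCeiling_of_histLipschitz_massBound_scaleAnchor_drift`: moduli with bounded mass + anchor + drift `OneLoopDrift s A b` (`0 < s`) and ANY
ceiling `c` with `s + 2A < c` ⟹ «∃ r γ₀ M′, 0 < γ₀ ≤ γ ∧ RunConstRemainder β b r γ₀ ∧ (∀ k, b k ≤ s + 2A) ∧ (s + 2A) + r ≤ c ∧ PS floor −M′ ∧ SurvCont β γ₀» (radius `min s (c − (s + 2A))`, p622247's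
lever; band `band_of_drift`; floor `runwisePS_of_drift_runConstRemainder`; (C) from the moduli); θ-keyed edition `runLettersAtCeiling_at` in the v9 stub-2ⱽ∘3ⱽ consequent shape (`w.βup ↦ c`).
§2 (at a `RecordSV` witness; the V-rungs BY NAME — DEF-1 g9's mirror `K1V9Defs`, p628520 = v9 :368–:410 verbatim): `runRowsContAtSomeRecord13PWSV_of_rung1VAt_cornerLetters_lt` (rung-1ⱽ data +
letters + open match `s + 2A < w.βup` ⟹ rung 2ⱽ‴ `RunRowsContAtSomeRecord13PWSV F`) · `runRowsAtSomeRecord13PWSV_of_rung1VAt_cornerLetters_lt` (rung 2ⱽ) · `…13PWSV_of_ceilingKeyedRung1V_cornerLetters`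
(`∀ c, ∃ w, c ≤ w.βup ∧ RecordSV ∧ nodes`, match-FREE) · ★ `stub_runRowsCont13VText_of_ceilingLiftV_liteText_cornerText` (the REGISTERED joint stub text «∀ F, NodesAtSomeRecord13PWSV F →
RunRowsContAtSomeRecord13PWSV F» (2ⱽ∘3ⱽ) from a CEILING-LIFT text on rung-1ⱽ worlds + the two corner letters keyed on provisos, unity∧slots and admissibility ALONE) · `stub_runRows13PWSVText_of_…` (the
registered `stub_runRows13PWSV` signature literally, same letters) · ★ `stub_cont13VText_of_histModuli` ∕ `…U` (the registered `stub_cont13V` signature literally FROM THE MODULI LETTER ALONE, via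
p621195 `cont13All_of_histModuliK` + DEF-1's `stub_cont13V_of_cont13All`, resp. directly at the witness with the unity-keyed letter); §2b `recordSV_reletter_ceiling` · `ceilingKeyedRung1V_of_nodes_of_b14Raise` · `…13PWSV_of_rung1VAt_b14Raise_cornerLetters` ·
★ `stub_runRowsCont13VText_of_n11CUV_liteText_cornerText` (the ceiling lift IS «N11 ceiling-uniform at the slot world», ONE node — the V-twins of `K1RunRowsTextOfN11CUOfRowsWF` §1–§2).  §3 K1⁹ BY NAME (the TYPE is the route decl literally; door = DEF-1's `…_of_rung0_runRowsContV` over dag-n13-w3's V-END road p627483):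
★★ `stabilityBRunRowsAtRecordR13SepCoPHV_of_ceilingKeyedRung1VWithMassBandCornerLetters` · `…V_of_rung1VWithMassBandCornerLetters` (the LINE-2 twins of p622247 :201 ∕ :214 — ∃-side producers,
letters AT THE WITNESS) · ★ `…V_of_ceilRung1VText_liteText_cornerText` (a ceiling-keyed stub-1ⱽ-shaped text + the two ∀θ corner letters ⟹ K1⁹) · ★★ `…V_of_stub1VText_ceilingLiftV_liteText_cornerText`
(the REGISTERED stub 1ⱽ text by name + ceiling lift + the two letters ⟹ K1⁹) · ★★ `…V_of_stubTextsV_cornerRoad` (the same through DEF-1's `…_of_stubTextsV`: stub 2ⱽ ⟸ {lift, moduli-with-mass, anchor,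
positive drift}, stub 3ⱽ ⟸ {moduli} — the LINE-2 ledger of the corner road) · ★★ `…V_of_stub1VText_n11CUV_liteText_cornerText` (lift ↦ N11CU at the slot world).

HONEST FRAMING.  Implications between displayed HYPOTHESIS SHAPES, p622247's elementary real-analysis lever, and dag-n13-w3's V-END road BY NAME; NOTHING of Bałaban's analysis is asserted or
discharged; whether U3ᴷ-lite ∕ the anchor ∕ the positive drift ∕ a (ceiling-keyed) `RecordSⱽ` world with the thirteen nodes are INHABITED at the record is the U3 ∕ N18 ∕ F-E ∕ (D1) ∕ N11 ∕ N13
desks' question, NOT claimed (instance 0∕1); no stub proved or closed; K0⁷ ∕ K1⁹ (v9 0∕6) ∕ K3⁸ OPEN; counts unmoved (typed 28∕28 · discharged 5∕27 (A 5∕28)); [Balaban1987RG1] Thm 2 + (0.31)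
p. 259 and §1's continuity pp. 263–264 are UNPROVED IN PRINT; [Balaban1988Convergent] Cor. 3 (2.50) is proved in no currency here; route R4 closes the CONDITIONAL finite-𝕋⁴ rung
`BalabanLadder.UV` only — NOT the continuum limit, NOT ℝ⁴, NOT OS, NOT the Yang–Mills mass gap, NOT Clay.  No `def`, no `instance`, no `notation`, no `axiom`.
Sources (context only): [I] = [Balaban1987RG1] CMP **109** (1987): (0.20) p. 256, Thm 2 p. 259, §1 pp. 263–264, Thm 3 p. 264, (2.12)–(2.14) p. 268, (5.10) p. 293, §5 p. 298;
[III] = [Balaban1988Convergent] CMP **119** (1988): Thm 1 p. 262, Cor. 3 (2.50) p. 264; [V] = [Balaban1989LargeFieldII] CMP **122** (1989): Thm 1 p. 355, (0.1) pp. 355–356;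
[II] = [Balaban1988RG2Cluster] CMP **116** (1988): Lemma 3 (2.38) p. 20, (2.41) p. 21.
-/

noncomputable section

open scoped Matrix.Norms.L2Operator

namespace Summit.QuantumFields.YangMills.Theorems.BalabanUVNodesK2CornerRoadLine2

open Literature.MathematicalPhysics.QuantumFieldTheory.Balaban1983to89
open Literature.MathematicalPhysics.QuantumFieldTheory.Balaban1983to89.T4Continuum
open Literature.MathematicalPhysics.QuantumFieldTheory.Balaban1983to89.DagBinding
open Literature.MathematicalPhysics.QuantumFieldTheory.Balaban1983to89.FlowStep
open Literature.MathematicalPhysics.QuantumFieldTheory.Balaban1983to89.FlowStepRuns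
open Literature.MathematicalPhysics.QuantumFieldTheory.Balaban1983to89.T4CouplingMatching (HistLipschitz)
open Literature.MathematicalPhysics.QuantumFieldTheory.Balaban1983to89.Beta.Drift (OneLoopDrift)
open Summit.QuantumFields.YangMills.Theorems.BalabanUVNodesK2NamedJetsRemAt (ScaleAnchor ConstRemainder band_of_drift)
open Summit.QuantumFields.YangMills.Theorems.BalabanUVNodesK2NamedJetsRunRemAt
  (RunConstRemainder SurvCont runwisePS_of_drift_runConstRemainder runConstRemainder_of_constRemainder)
open Summit.QuantumFields.YangMills.Theorems.K1V6Defs (Inhabited13)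
open Summit.QuantumFields.YangMills.Theorems.BalabanUVNodesK1R8RowsDefs (Cont13All)
open Summit.QuantumFields.YangMills.Theorems.K1V9Defs
  (RecordSV NodesAtSomeRecord13PWSV RunRowsAtSomeRecord13PWSV RunRowsContAtSomeRecord13PWSV runRowsAtSomeRecord13PWSV_of_runRowsContAtSomeRecord13PWSV
    stub_cont13V_of_cont13All stabilityBRunRowsAtRecordR13SepCoPHV_of_rung0_runRowsContV stabilityBRunRowsAtRecordR13SepCoPHV_of_stubTextsV)
open Summit.QuantumFields.YangMills.Theses.BalabanUVNodes (StabilityBRunRowsAtRecordR13SepCoPHV)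
open Summit.QuantumFields.YangMills.Theorems.BalabanUVNodesK2CornerRoadRows (cont13All_of_histModuliK)
open Summit.QuantumFields.YangMills.Theorems.BalabanUVNodesK2CornerRoadRowsMassBand (constRemainder_of_histLipschitz_massBound_scaleAnchor)
open Summit.QuantumFields.YangMills.Theorems.BalabanUVNodesK1RunRowsTextOfN11CUOfRowsWF (nodes_leavesP_reletter_ceiling_all)

/-! ## §1 The run-letter bundle of the V-stubs 2ⱽ∘3ⱽ at ANY ceiling above the drift band (generic, slot-free) -/

section Generic

variable {β : HBeta} {b : ℕ → ℝ} {Λ : ℕ → ℕ → ℝ} {γ M s A c : ℝ}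

/-- **★ THE RUN LETTERS AT A CEILING (generic `β`)**: history moduli `HistLipschitz Λ γ β` (`0 < γ`) with BOUNDED MASS `Σ_{i : Fin (k+1)} |Λ k i| ≤ M`, a per-scale anchor `ScaleAnchor β b`,
a one-loop drift `OneLoopDrift s A b` with `0 < s`, and ANY ceiling `c` with `s + 2A < c` ⟹ on SOME level `0 < γ₀ ≤ γ`: (i) the run-wise constant remainder `RunConstRemainder β b r γ₀`
with radius `r := min s (c − (s + 2A))` (p622247's lever `constRemainder_of_histLipschitz_massBound_scaleAnchor`, restricted to runs), (ii) the band `b_k ≤ s + 2A` (`band_of_drift`),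
(iii) the match `(s + 2A) + r ≤ c`, (iv) the run-wise partial-sum floor `−2A` (`runwisePS_of_drift_runConstRemainder`, cap `r ≤ s`), and (C) `SurvCont β γ₀` from the moduli
(`betaContH_of_histLipschitz`, `SurvCont.of_betaContH`).  CONDITIONAL on four hypothesis shapes; instance 0∕1; nothing of Bałaban asserted.
[cite: Balaban1987RG1, Thm 3 p.264, (2.12)-(2.14) p.268, (5.10) p.293, §1 pp.263-264 and §5 p.298; Balaban1988RG2Cluster, Lemma 3 (2.38) p.20, (2.41) p.21 (statement shapes)] -/
theorem runLettersAtCeiling_of_histLipschitz_massBound_scaleAnchor_drift (hγ : 0 < γ) (hL : HistLipschitz Λ γ β) (hM : ∀ k, ∑ i : Fin (k + 1), |Λ k i| ≤ M)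
    (hb : ScaleAnchor β b) (hs : 0 < s) (hdrift : OneLoopDrift s A b) (hc : s + 2 * A < c) :
    ∃ (r γ₀ : ℝ), 0 < γ₀ ∧ γ₀ ≤ γ ∧ RunConstRemainder β b r γ₀ ∧ (∀ k, b k ≤ s + 2 * A) ∧ s + 2 * A + r ≤ c ∧
      (∀ (n : ℕ) (gs : ℕ → ℝ), RGEqH n β gs → Step.InInterval γ₀ n gs → ∀ k, k ≤ n → -(2 * A) ≤ ∑ j ∈ Finset.Ico k n, β j (prefixOf gs j)) ∧
      SurvCont β γ₀ := by
  have hr : 0 < min s (c - (s + 2 * A)) := lt_min hs (by linarith)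
  obtain ⟨γr, hγr, hle, hrem⟩ := constRemainder_of_histLipschitz_massBound_scaleAnchor hγ hL hM hb hr
  have hrun := runConstRemainder_of_constRemainder hrem
  have hband : ∀ k, b k ≤ s + 2 * A := fun k => by
    have := (abs_le.mp (band_of_drift hdrift k)).2
    linarith
  have hmatch : s + 2 * A + min s (c - (s + 2 * A)) ≤ c := by
    have := min_le_right s (c - (s + 2 * A))
    linarith
  exact ⟨_, γr, hγr, hle, hrun, hband, hmatch, runwisePS_of_drift_runConstRemainder hdrift hrun (min_le_left _ _),
    SurvCont.of_betaContH hγr fun k => (T4BetaStationary.betaContH_of_histLipschitz hL k).mono (box_mono hle k)⟩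

end Generic

section AtTuple

variable {F : T4Family}

/-- **THE RUN LETTERS AT A CEILING, θ-keyed** — the v9 stub-2ⱽ∘3ⱽ consequent shape (`K1V9Defs.RunRowsContAtSomeRecord13PWSV`'s last conjunct block) with the world's ceiling `w.βup`
replaced by ANY `c` above the drift band (= the consequent of dag-n13-w3's `h₂` in p627483 `…_of_stubTextsV`): at an admissible Stage-13 tuple `θ` (window `0 < θ.γ` from admissibility),
U3ᴷ-lite moduli-with-mass for `β_θ := Node00.betaOfRecord₁₃ F 2 θ.toStage13Params`, an anchor and a positive drift ⟹ «∃ b r γ₀ B M, 0 < γ₀ ∧ RunConstRemainder β_θ b r γ₀ ∧ (∀ k, b k ≤ B) ∧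
B + r ≤ c ∧ PS floor −M ∧ SurvCont β_θ γ₀».  θ-level, slot-free, (B)-free.  CONDITIONAL; instance 0∕1.
[cite: Balaban1987RG1, Thm 3 p.264, (2.12)-(2.14) p.268, (5.10) p.293, §1 pp.263-264 and §5 p.298; Balaban1988RG2Cluster, (2.41) p.21 (statement shapes)] -/
theorem runLettersAtCeiling_at (θ : Node00.Stage13HParams F 2) (hθ : θ.Admissible F 2) {Λ : ℕ → ℕ → ℝ} {M : ℝ}
    (hL : HistLipschitz Λ θ.γ (Node00.betaOfRecord₁₃ F 2 θ.toStage13Params)) (hM : ∀ k, ∑ i : Fin (k + 1), |Λ k i| ≤ M)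
    {b : ℕ → ℝ} {s A : ℝ} (hb : ScaleAnchor (Node00.betaOfRecord₁₃ F 2 θ.toStage13Params) b) (hs : 0 < s) (hdrift : OneLoopDrift s A b) {c : ℝ} (hc : s + 2 * A < c) :
    ∃ (b : ℕ → ℝ) (r γ₀ B M : ℝ), 0 < γ₀ ∧ RunConstRemainder (Node00.betaOfRecord₁₃ F 2 θ.toStage13Params) b r γ₀ ∧ (∀ k, b k ≤ B) ∧ B + r ≤ c ∧
      (∀ (n : ℕ) (gs : ℕ → ℝ), RGEqH n (Node00.betaOfRecord₁₃ F 2 θ.toStage13Params) gs → Step.InInterval γ₀ n gs →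
        ∀ k, k ≤ n → -M ≤ ∑ j ∈ Finset.Ico k n, Node00.betaOfRecord₁₃ F 2 θ.toStage13Params j (prefixOf gs j)) ∧
      SurvCont (Node00.betaOfRecord₁₃ F 2 θ.toStage13Params) γ₀ := by
  obtain ⟨r, γ₀, hγ₀, -, hrun, hband, hmatch, hps, hsc⟩ :=
    runLettersAtCeiling_of_histLipschitz_massBound_scaleAnchor_drift hθ.toStage12.toStage9.gamma_pos hL hM hb hs hdrift hc
  exact ⟨b, r, γ₀, s + 2 * A, 2 * A, hγ₀, hrun, hband, hmatch, hps, hsc⟩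

end AtTuple

/-! ## §2 At a `RecordSⱽ` witness: the V-rungs BY NAME (DEF-1's `K1V9Defs`, p628520 = v9 :368–:410 verbatim) from rung-1ⱽ data + the corner letters -/

section SlotWitness

variable {F : T4Family}

/-- **RUNG 2ⱽ‴ `RunRowsContAtSomeRecord13PWSV F` (the CONCLUSION of the registered `stub_cont13V`) FROM RUNG-1ⱽ DATA + THE CORNER LETTERS, ANY SLACK**: a unity admissible tuple `(θ, h)`, a slot
`v : Node00.Revision₁₃ F 2 θ h`, a world in the slot class `RecordSV F θ h v w` with the thirteen nodes at every run, U3ᴷ-lite moduli-with-mass, anchor, positive drift, and the OPEN match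
`s + 2A < w.βup` ⟹ rung 2ⱽ‴ at the SAME witness (§1 at `c := w.βup`).  CONDITIONAL; closes nothing.
[cite: Balaban1989LargeFieldII, Thm 1 p.355 and (0.1) pp.355-356; Balaban1987RG1, Thm 3 p.264, (2.12)-(2.14) p.268, (5.10) p.293, §1 pp.263-264; Balaban1988RG2Cluster, (2.41) p.21 (statement shapes)] -/
theorem runRowsContAtSomeRecord13PWSV_of_rung1VAt_cornerLetters_lt (θ : Node00.Stage13HParams F 2) (h : θ.Provisos₁₃SepCoPH F 2) (v : Node00.Revision₁₃ F 2 θ h) (w : WorldP)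
    (hU : θ.ZhUnity F 2 ∧ θ.SlotsNondegenerate₁₃ F 2) (hθ : θ.Admissible F 2) (hRV : RecordSV F θ h v w) (hnodes : ∀ P : B12.RunParams, Nodes (leavesP w P))
    {Λ : ℕ → ℕ → ℝ} {M : ℝ} (hL : HistLipschitz Λ θ.γ (Node00.betaOfRecord₁₃ F 2 θ.toStage13Params)) (hM : ∀ k, ∑ i : Fin (k + 1), |Λ k i| ≤ M)
    {b : ℕ → ℝ} {s A : ℝ} (hb : ScaleAnchor (Node00.betaOfRecord₁₃ F 2 θ.toStage13Params) b) (hs : 0 < s) (hdrift : OneLoopDrift s A b) (hmatch : s + 2 * A < w.βup) :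
    RunRowsContAtSomeRecord13PWSV F :=
  ⟨θ, h, v, w, hU, hθ, hRV, hnodes, runLettersAtCeiling_at θ hθ hL hM hb hs hdrift hmatch⟩

/-- **RUNG 2ⱽ `RunRowsAtSomeRecord13PWSV F` (the CONCLUSION of the registered `stub_runRows13PWSV`) from the same data** — rung 2ⱽ‴ with (C) dropped (`K1V9Defs.runRowsAtSomeRecord13PWSV_of_runRowsContAtSomeRecord13PWSV`).
CONDITIONAL; closes nothing. [cite: Balaban1987RG1, Thm 3 p.264, (2.12)-(2.14) p.268, (5.10) p.293 (statement shapes)] -/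
theorem runRowsAtSomeRecord13PWSV_of_rung1VAt_cornerLetters_lt (θ : Node00.Stage13HParams F 2) (h : θ.Provisos₁₃SepCoPH F 2) (v : Node00.Revision₁₃ F 2 θ h) (w : WorldP)
    (hU : θ.ZhUnity F 2 ∧ θ.SlotsNondegenerate₁₃ F 2) (hθ : θ.Admissible F 2) (hRV : RecordSV F θ h v w) (hnodes : ∀ P : B12.RunParams, Nodes (leavesP w P))
    {Λ : ℕ → ℕ → ℝ} {M : ℝ} (hL : HistLipschitz Λ θ.γ (Node00.betaOfRecord₁₃ F 2 θ.toStage13Params)) (hM : ∀ k, ∑ i : Fin (k + 1), |Λ k i| ≤ M)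
    {b : ℕ → ℝ} {s A : ℝ} (hb : ScaleAnchor (Node00.betaOfRecord₁₃ F 2 θ.toStage13Params) b) (hs : 0 < s) (hdrift : OneLoopDrift s A b) (hmatch : s + 2 * A < w.βup) :
    RunRowsAtSomeRecord13PWSV F :=
  runRowsAtSomeRecord13PWSV_of_runRowsContAtSomeRecord13PWSV F
    (runRowsContAtSomeRecord13PWSV_of_rung1VAt_cornerLetters_lt θ h v w hU hθ hRV hnodes hL hM hb hs hdrift hmatch)

/-- **RUNG 2ⱽ‴ MATCH-FREE (ceiling-keyed rung 1ⱽ)**: the N11CU-style family `∀ c, ∃ w, c ≤ w.βup ∧ RecordSV F θ h v w ∧ ∀ P, Nodes (leavesP w P)` at ONE slot `(θ, h, v)` (the LINE-2 twin of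
dag-n24-w1's p620073 family) + the corner letters ⟹ `RunRowsContAtSomeRecord13PWSV F`: request the world at `s + 2A + 1`, then the theorem above.  No numeric letter.  CONDITIONAL; closes nothing.
[cite: Balaban1988Convergent, Thm 1 p.262; Balaban1989LargeFieldII, Thm 1 p.355; Balaban1987RG1, Thm 3 p.264, (2.12)-(2.14) p.268, (5.10) p.293, §1 pp.263-264 (statement shapes)] -/
theorem runRowsContAtSomeRecord13PWSV_of_ceilingKeyedRung1V_cornerLetters (θ : Node00.Stage13HParams F 2) (h : θ.Provisos₁₃SepCoPH F 2) (v : Node00.Revision₁₃ F 2 θ h)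
    (hU : θ.ZhUnity F 2 ∧ θ.SlotsNondegenerate₁₃ F 2) (hθ : θ.Admissible F 2)
    (hfam : ∀ c : ℝ, ∃ w : WorldP, c ≤ w.βup ∧ RecordSV F θ h v w ∧ ∀ P : B12.RunParams, Nodes (leavesP w P))
    {Λ : ℕ → ℕ → ℝ} {M : ℝ} (hL : HistLipschitz Λ θ.γ (Node00.betaOfRecord₁₃ F 2 θ.toStage13Params)) (hM : ∀ k, ∑ i : Fin (k + 1), |Λ k i| ≤ M)
    {b : ℕ → ℝ} {s A : ℝ} (hb : ScaleAnchor (Node00.betaOfRecord₁₃ F 2 θ.toStage13Params) b) (hs : 0 < s) (hdrift : OneLoopDrift s A b) :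
    RunRowsContAtSomeRecord13PWSV F := by
  obtain ⟨w, hc, hRV, hnodes⟩ := hfam (s + 2 * A + 1)
  exact runRowsContAtSomeRecord13PWSV_of_rung1VAt_cornerLetters_lt θ h v w hU hθ hRV hnodes hL hM hb hs hdrift (by linarith)

/-- **★ THE REGISTERED JOINT STUB TEXT 2ⱽ∘3ⱽ «∀ F, NodesAtSomeRecord13PWSV F → RunRowsContAtSomeRecord13PWSV F» BY NAME FROM THREE K1-SIDE LETTERS**: (a) a CEILING LIFT on rung-1ⱽ worlds
«at a unity admissible `(θ, h)`, slot `v`, given ONE `RecordSV` world with the thirteen nodes, such a world exists above EVERY ceiling `c`» (the N11CU currency of LINE 1 — of the thirteen mains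
only N11 reads `w.βup` — keyed at the slot; the N-engine ∕ N11 desks' letter), (b) U3ᴷ-lite moduli-with-mass for `β_θ` and (c) an anchor with a POSITIVE drift, (b)(c) keyed on provisos,
unity∧slots and admissibility ALONE (no (B), no window, no slot: on LINE 2 nothing else is available at rung 1ⱽ — the honest K1-side currency of the U3 ∕ N18 ∕ F-E ∕ (D1) desks' letters).
The stub-1ⱽ pins (N08 `PrintedUV3V`, N12's [IV] basic step) are read and dropped.  CONDITIONAL on three displayed texts (none supplied here); closes NO stub by itself; nothing of Bałaban asserted.
[cite: Balaban1988Convergent, Thm 1 p.262; Balaban1989LargeFieldII, Thm 1 p.355 and (0.1) pp.355-356; Balaban1987RG1, Thm 3 p.264, (2.12)-(2.14) p.268, (5.10) p.293, §1 pp.263-264 and §5 p.298 (statement shapes)] -/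
theorem stub_runRowsCont13VText_of_ceilingLiftV_liteText_cornerText
    (hLift : ∀ (F : T4Family) (θ : Node00.Stage13HParams F 2) (h : θ.Provisos₁₃SepCoPH F 2) (v : Node00.Revision₁₃ F 2 θ h) (w : WorldP),
      (θ.ZhUnity F 2 ∧ θ.SlotsNondegenerate₁₃ F 2) → θ.Admissible F 2 → RecordSV F θ h v w → (∀ P : B12.RunParams, Nodes (leavesP w P)) →
      ∀ c : ℝ, ∃ w' : WorldP, c ≤ w'.βup ∧ RecordSV F θ h v w' ∧ ∀ P : B12.RunParams, Nodes (leavesP w' P))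
    (hLite : ∀ (F : T4Family) (θ : Node00.Stage13HParams F 2), θ.Provisos₁₃SepCoPH F 2 → (θ.ZhUnity F 2 ∧ θ.SlotsNondegenerate₁₃ F 2) → θ.Admissible F 2 →
      ∃ (Λ : ℕ → ℕ → ℝ) (M : ℝ), HistLipschitz Λ θ.γ (Node00.betaOfRecord₁₃ F 2 θ.toStage13Params) ∧ ∀ k, ∑ i : Fin (k + 1), |Λ k i| ≤ M)
    (hCD : ∀ (F : T4Family) (θ : Node00.Stage13HParams F 2), θ.Provisos₁₃SepCoPH F 2 → (θ.ZhUnity F 2 ∧ θ.SlotsNondegenerate₁₃ F 2) → θ.Admissible F 2 →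
      ∃ (b : ℕ → ℝ) (s A : ℝ), ScaleAnchor (Node00.betaOfRecord₁₃ F 2 θ.toStage13Params) b ∧ 0 < s ∧ OneLoopDrift s A b) :
    ∀ F : T4Family, NodesAtSomeRecord13PWSV F → RunRowsContAtSomeRecord13PWSV F := by
  intro F hN
  obtain ⟨θ, h, v, w, hU, hθ, hRV, hnodes, -, -⟩ := hN
  obtain ⟨Λ, M, hL, hM⟩ := hLite F θ h hU hθ
  obtain ⟨b, s, A, hb, hs, hdrift⟩ := hCD F θ h hU hθ
  exact runRowsContAtSomeRecord13PWSV_of_ceilingKeyedRung1V_cornerLetters θ h v hU hθ (hLift F θ h v w hU hθ hRV hnodes) hL hM hb hs hdrift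

/-- **… HENCE THE REGISTERED `stub_runRows13PWSV` SIGNATURE `∀ F, NodesAtSomeRecord13PWSV F → RunRowsAtSomeRecord13PWSV F` LITERALLY, under the same three letters** ((C) dropped).  CONDITIONAL on
the letters (none supplied here); the registered stub is NOT closed by this theorem. [cite: Balaban1987RG1, Thm 3 p.264, (2.12)-(2.14) p.268, (5.10) p.293 (statement shapes)] -/
theorem stub_runRows13PWSVText_of_ceilingLiftV_liteText_cornerText
    (hLift : ∀ (F : T4Family) (θ : Node00.Stage13HParams F 2) (h : θ.Provisos₁₃SepCoPH F 2) (v : Node00.Revision₁₃ F 2 θ h) (w : WorldP),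
      (θ.ZhUnity F 2 ∧ θ.SlotsNondegenerate₁₃ F 2) → θ.Admissible F 2 → RecordSV F θ h v w → (∀ P : B12.RunParams, Nodes (leavesP w P)) →
      ∀ c : ℝ, ∃ w' : WorldP, c ≤ w'.βup ∧ RecordSV F θ h v w' ∧ ∀ P : B12.RunParams, Nodes (leavesP w' P))
    (hLite : ∀ (F : T4Family) (θ : Node00.Stage13HParams F 2), θ.Provisos₁₃SepCoPH F 2 → (θ.ZhUnity F 2 ∧ θ.SlotsNondegenerate₁₃ F 2) → θ.Admissible F 2 →
      ∃ (Λ : ℕ → ℕ → ℝ) (M : ℝ), HistLipschitz Λ θ.γ (Node00.betaOfRecord₁₃ F 2 θ.toStage13Params) ∧ ∀ k, ∑ i : Fin (k + 1), |Λ k i| ≤ M)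
    (hCD : ∀ (F : T4Family) (θ : Node00.Stage13HParams F 2), θ.Provisos₁₃SepCoPH F 2 → (θ.ZhUnity F 2 ∧ θ.SlotsNondegenerate₁₃ F 2) → θ.Admissible F 2 →
      ∃ (b : ℕ → ℝ) (s A : ℝ), ScaleAnchor (Node00.betaOfRecord₁₃ F 2 θ.toStage13Params) b ∧ 0 < s ∧ OneLoopDrift s A b) :
    ∀ F : T4Family, NodesAtSomeRecord13PWSV F → RunRowsAtSomeRecord13PWSV F :=
  fun F hN => runRowsAtSomeRecord13PWSV_of_runRowsContAtSomeRecord13PWSV F (stub_runRowsCont13VText_of_ceilingLiftV_liteText_cornerText hLift hLite hCD F hN)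

/-- **★ THE REGISTERED `stub_cont13V` SIGNATURE `∀ F, RunRowsAtSomeRecord13PWSV F → RunRowsContAtSomeRecord13PWSV F` LITERALLY, FROM THE MODULI LETTER ALONE** (no mass bound, no anchor, no drift,
no lift): history moduli `HistLipschitz Λ θ.γ β_θ` at every admissible Stage-13 tuple with provisos ⟹ DEF-1's `Cont13All` (p621195 `cont13All_of_histModuliK`: box continuity from the moduli,
restricted to the level, `SurvCont.of_betaContH`) ⟹ stub 3ⱽ's text (DEF-1's `K1V9Defs.stub_cont13V_of_cont13All`: (C) read at the presenting tuple of `RecordSV`, level cut to `min γ₀ w.γ`).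
So on the corner road [Balaban1987RG1] §1's continuity sentence for LINE 2 is OWED BY THE MODULI desks, exactly as for LINE 1 (p621195 `stub_cont13Text_of_histModuliK`).  CONDITIONAL on
the letter; the registered stub is NOT closed by this theorem. [cite: Balaban1987RG1, §1 pp.263-264, (2.13) p.268 and Thm 3 p.264] -/
theorem stub_cont13VText_of_histModuli
    (hMod : ∀ (F : T4Family) (θ : Node00.Stage13HParams F 2), θ.Provisos₁₃SepCoPH F 2 → θ.Admissible F 2 →
      ∃ Λ : ℕ → ℕ → ℝ, HistLipschitz Λ θ.γ (Node00.betaOfRecord₁₃ F 2 θ.toStage13Params)) :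
    ∀ F : T4Family, RunRowsAtSomeRecord13PWSV F → RunRowsContAtSomeRecord13PWSV F :=
  stub_cont13V_of_cont13All (cont13All_of_histModuliK fun F θ hP hθ => hMod F θ hP hθ)

/-- **THE REGISTERED `stub_cont13V` SIGNATURE FROM THE MODULI LETTER KEYED LIKE THE OTHER CORNER LETTERS** (provisos, unity∧slots, admissibility — the antecedents a rung-2ⱽ witness carries):
keep the witness `(θ, h, v, w)` and its rows, cut the level to `min γ₀ θ.γ` (`RunConstRemainder.mono`; the floor restricted to the in-window runs of the smaller level), and read (C) there from
the moduli of `β_θ` on the box of side `θ.γ` (`betaContH_of_histLipschitz`, `SurvCont.of_betaContH`).  So U3ᴷ-lite's moduli half ALONE pays stub 3ⱽ.  CONDITIONAL on the letter; the registered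
stub is NOT closed by this theorem. [cite: Balaban1987RG1, §1 pp.263-264, (2.13) p.268 and Thm 3 p.264] -/
theorem stub_cont13VText_of_histModuliU
    (hMod : ∀ (F : T4Family) (θ : Node00.Stage13HParams F 2), θ.Provisos₁₃SepCoPH F 2 → (θ.ZhUnity F 2 ∧ θ.SlotsNondegenerate₁₃ F 2) → θ.Admissible F 2 →
      ∃ Λ : ℕ → ℕ → ℝ, HistLipschitz Λ θ.γ (Node00.betaOfRecord₁₃ F 2 θ.toStage13Params)) :
    ∀ F : T4Family, RunRowsAtSomeRecord13PWSV F → RunRowsContAtSomeRecord13PWSV F := by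
  intro F hrows
  obtain ⟨θ, h, v, w, hU, hθ, hRV, hnodes, b, r, γ₀, B, M, hγ₀, hrem, hB, hmatch, hps⟩ := hrows
  obtain ⟨Λ, hL⟩ := hMod F θ h hU hθ
  have hγ : 0 < θ.γ := hθ.toStage12.toStage9.gamma_pos
  have hγ₁ : 0 < min γ₀ θ.γ := lt_min hγ₀ hγ
  refine ⟨θ, h, v, w, hU, hθ, hRV, hnodes, b, r, min γ₀ θ.γ, B, M, hγ₁, hrem.mono (min_le_left _ _), hB, hmatch, ?_,
    SurvCont.of_betaContH hγ₁ fun k => (T4BetaStationary.betaContH_of_histLipschitz hL k).mono (box_mono (min_le_right _ _) k)⟩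
  intro n gs hrg hI k hk
  exact hps n gs hrg (fun j hj => ⟨(hI j hj).1, (hI j hj).2.trans (min_le_left _ _)⟩) k hk

/-! ### §2b The ceiling lift IS «N11 ceiling-uniform at the slot world» (`N11CU`, one node): the V-twins of `K1RunRowsTextOfN11CUOfRowsWF` §1–§2 -/

/-- The slot class `RecordSV` does not read `βup` and accepts any smaller positive window (the V-twin of `K1RunRowsTextOfN11CUOfRowsWF.recordS_reletter_ceiling`; the construction
clause `w.C = (datumOfRecord₁₃SepCoPHV θ h v).C` is untouched by the re-lettering). [cite: Balaban1989LargeFieldII, Thm 1 p.355 (bookkeeping)] -/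
theorem recordSV_reletter_ceiling {θ : Node00.Stage13HParams F 2} {h : θ.Provisos₁₃SepCoPH F 2} {v : Node00.Revision₁₃ F 2 θ h} {w : WorldP} (hR : RecordSV F θ h v w) (c : ℝ)
    {γ' : ℝ} (hγ'0 : 0 < γ') (hγ' : γ' ≤ w.γ) : RecordSV F θ h v { w with βup := c, γ := γ' } := by
  obtain ⟨θ', h', hθ', hD, hC, hγ, hL, hup⟩ := hR
  exact ⟨θ', h', hθ', hD, hC, ⟨hγ'0, hγ'.trans hγ.2⟩, hL, hup⟩

/-- **THE CEILING-KEYED RUNG-1ⱽ FAMILY FROM ONE SLOT WITNESS AND THE N11 RAISE** (the V-twin of `K1RunRowsTextOfN11CUOfRowsWF.ceilingKeyedRung1_of_nodes_of_b14Raise`): at ONE rung-1ⱽ core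
datum `(θ, h, v, w)` (`RecordSV`, the thirteen nodes at every run), if N11 = `Dag.B14_main` holds at EVERY ceiling letter `c` after re-lettering the window to SOME `γ' ∈ ]0, w.γ]` ([III] Thm 1
p.262 with the constant `β′` of (2.6) a PARAMETER), then `∀ c, ∃ w', c ≤ w'.βup ∧ RecordSV F θ h v w' ∧ ∀ P, Nodes (leavesP w' P)` — the world is `{w with βup := c, γ := γ'}`; the other
twelve mains are `βup`-free and antitone in `γ` (`nodes_leavesP_reletter_ceiling_all`).  So §2's «ceiling lift» costs EXACTLY ONE NODE, N11, at the slot world.  CONDITIONAL on `hraise`.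
[cite: Balaban1988Convergent, Thm 1 p.262, (2.6) p.255; Balaban1989LargeFieldII, Thm 1 p.355 and Introduction pp.355-356 (bookkeeping)] -/
theorem ceilingKeyedRung1V_of_nodes_of_b14Raise (θ : Node00.Stage13HParams F 2) (h : θ.Provisos₁₃SepCoPH F 2) (v : Node00.Revision₁₃ F 2 θ h) (w : WorldP)
    (hR : RecordSV F θ h v w) (hnodes : ∀ P : B12.RunParams, Nodes (leavesP w P))
    (hraise : ∀ c : ℝ, ∃ γ' : ℝ, 0 < γ' ∧ γ' ≤ w.γ ∧ ∀ P : B12.RunParams, Dag.B14_main (leavesP { w with βup := c, γ := γ' } P)) :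
    ∀ c : ℝ, ∃ w' : WorldP, c ≤ w'.βup ∧ RecordSV F θ h v w' ∧ ∀ P : B12.RunParams, Nodes (leavesP w' P) := fun c => by
  obtain ⟨γ', hγ'0, hγ', h14⟩ := hraise c
  exact ⟨{ w with βup := c, γ := γ' }, le_rfl, recordSV_reletter_ceiling hR c hγ'0 hγ', nodes_leavesP_reletter_ceiling_all w hγ' hnodes h14⟩

/-- **RUNG 2ⱽ‴ FROM ONE RUNG-1ⱽ CORE DATUM, THE N11 RAISE THERE, AND THE CORNER LETTERS** (no numeric match, no ceiling-keyed family as input).  CONDITIONAL; closes nothing.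
[cite: Balaban1988Convergent, Thm 1 p.262, (2.6) p.255; Balaban1987RG1, Thm 3 p.264, (2.12)-(2.14) p.268, (5.10) p.293, §1 pp.263-264 and §5 p.298 (statement shapes)] -/
theorem runRowsContAtSomeRecord13PWSV_of_rung1VAt_b14Raise_cornerLetters (θ : Node00.Stage13HParams F 2) (h : θ.Provisos₁₃SepCoPH F 2) (v : Node00.Revision₁₃ F 2 θ h) (w : WorldP)
    (hU : θ.ZhUnity F 2 ∧ θ.SlotsNondegenerate₁₃ F 2) (hθ : θ.Admissible F 2) (hR : RecordSV F θ h v w) (hnodes : ∀ P : B12.RunParams, Nodes (leavesP w P))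
    (hraise : ∀ c : ℝ, ∃ γ' : ℝ, 0 < γ' ∧ γ' ≤ w.γ ∧ ∀ P : B12.RunParams, Dag.B14_main (leavesP { w with βup := c, γ := γ' } P))
    {Λ : ℕ → ℕ → ℝ} {M : ℝ} (hL : HistLipschitz Λ θ.γ (Node00.betaOfRecord₁₃ F 2 θ.toStage13Params)) (hM : ∀ k, ∑ i : Fin (k + 1), |Λ k i| ≤ M)
    {b : ℕ → ℝ} {s A : ℝ} (hb : ScaleAnchor (Node00.betaOfRecord₁₃ F 2 θ.toStage13Params) b) (hs : 0 < s) (hdrift : OneLoopDrift s A b) :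
    RunRowsContAtSomeRecord13PWSV F :=
  runRowsContAtSomeRecord13PWSV_of_ceilingKeyedRung1V_cornerLetters θ h v hU hθ (ceilingKeyedRung1V_of_nodes_of_b14Raise θ h v w hR hnodes hraise) hL hM hb hs hdrift

/-- **★ THE REGISTERED JOINT STUB TEXT 2ⱽ∘3ⱽ FROM «N11 CEILING-UNIFORM AT RUNG-1ⱽ CORE DATA» + THE TWO ∀θ CORNER LETTERS** (the V-twin of CRIT-1 g4's `hN11` in
`K1RunRowsTextOfN11CUOfRowsWF.stub2V6_of_n11CU_stub2WF`, with the β cell's match-free rows REPLACED by the corner letters): `hN11V` = at every `(θ, h, v, w)` with unity∧slots, admissibility,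
`RecordSV`, nodes at every run, and for EVERY ceiling letter `c`, SOME window `γ' ∈ ]0, w.γ]` with `Dag.B14_main` at `{w with βup := c, γ := γ'}` on every run ([III] Thm 1 with `β′` a
parameter — N11's lane); `hLite`, `hCD` as in §2.  So on LINE 2 the corner road's bill for stubs 2ⱽ∘3ⱽ is {N11CU at the slot world; U3ᴷ-lite; anchor + positive drift} — ONE node and two β
letters.  CONDITIONAL on three displayed texts (none supplied here); closes NO stub by itself; nothing of Bałaban asserted.
[cite: Balaban1988Convergent, Thm 1 p.262, (2.6) p.255; Balaban1989LargeFieldII, Thm 1 p.355; Balaban1987RG1, Thm 3 p.264, (2.12)-(2.14) p.268, (5.10) p.293, §1 pp.263-264 and §5 p.298 (statement shapes)] -/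
theorem stub_runRowsCont13VText_of_n11CUV_liteText_cornerText
    (hN11V : ∀ (F : T4Family) (θ : Node00.Stage13HParams F 2) (h : θ.Provisos₁₃SepCoPH F 2) (v : Node00.Revision₁₃ F 2 θ h) (w : WorldP),
      (θ.ZhUnity F 2 ∧ θ.SlotsNondegenerate₁₃ F 2) → θ.Admissible F 2 → RecordSV F θ h v w → (∀ P : B12.RunParams, Nodes (leavesP w P)) →
      ∀ c : ℝ, ∃ γ' : ℝ, 0 < γ' ∧ γ' ≤ w.γ ∧ ∀ P : B12.RunParams, Dag.B14_main (leavesP { w with βup := c, γ := γ' } P))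
    (hLite : ∀ (F : T4Family) (θ : Node00.Stage13HParams F 2), θ.Provisos₁₃SepCoPH F 2 → (θ.ZhUnity F 2 ∧ θ.SlotsNondegenerate₁₃ F 2) → θ.Admissible F 2 →
      ∃ (Λ : ℕ → ℕ → ℝ) (M : ℝ), HistLipschitz Λ θ.γ (Node00.betaOfRecord₁₃ F 2 θ.toStage13Params) ∧ ∀ k, ∑ i : Fin (k + 1), |Λ k i| ≤ M)
    (hCD : ∀ (F : T4Family) (θ : Node00.Stage13HParams F 2), θ.Provisos₁₃SepCoPH F 2 → (θ.ZhUnity F 2 ∧ θ.SlotsNondegenerate₁₃ F 2) → θ.Admissible F 2 →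
      ∃ (b : ℕ → ℝ) (s A : ℝ), ScaleAnchor (Node00.betaOfRecord₁₃ F 2 θ.toStage13Params) b ∧ 0 < s ∧ OneLoopDrift s A b) :
    ∀ F : T4Family, NodesAtSomeRecord13PWSV F → RunRowsContAtSomeRecord13PWSV F :=
  stub_runRowsCont13VText_of_ceilingLiftV_liteText_cornerText
    (fun F θ h v w hU hθ hR hnodes => ceilingKeyedRung1V_of_nodes_of_b14Raise θ h v w hR hnodes (hN11V F θ h v w hU hθ hR hnodes)) hLite hCD

end SlotWitness

/-! ## §3 K1⁹ BY NAME on LINE 2 (the TYPE is the route decl literally; the slot is the witness's own `v`; door = DEF-1's `…_of_rung0_runRowsContV` over dag-n13-w3's V-END road p627483) -/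

section Witness

/-- **★★ K1⁹ stmt-QuantumFields-27364 BY NAME ON THE MASS-BAND ROAD, LINE 2 — N17-FREE, MATCH-FREE** (the LINE-2 twin of p626226 :82 ∕ p622247 :201): for every family with a unity Stage-13
tuple, SOME unity admissible tuple `(θ, h)` with provisos and SOME slot `v : Node00.Revision₁₃ F 2 θ h` carry a CEILING-KEYED family of `RecordSV` worlds of the REVISED datum with the thirteen
nodes (the rung-1ⱽ lanes' export — N13 read at the re-chosen densities `v.ρ`), U3ᴷ-lite moduli-with-mass for `β_θ`, and a per-scale anchor drifting with a POSITIVE slope ⟹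
`…Theses.BalabanUVNodes.StabilityBRunRowsAtRecordR13SepCoPHV` — (B) at `(datumOfRecord₁₃SepCoPHV θ h v).C` and the window manufactured by dag-n13-w3's V-END road (through
`K1V9Defs.stabilityBRunRowsAtRecordR13SepCoPHV_of_rung0_runRowsContV`) from §2's rung 2ⱽ‴.  CONDITIONAL on `hprod` (not supplied here); K1⁹ NOT closed by this theorem; nothing of Bałaban
asserted; no count moved. [cite: Balaban1989LargeFieldII, Thm 1 p.355 and (0.1) pp.355-356; Balaban1988Convergent, Thm 1 p.262, (2.6) p.255, Cor. 3 (2.50) p.264; Balaban1987RG1, (0.20) p.256, Thm 2 p.259 (first sentence), Thm 3 p.264, (2.12)-(2.14) p.268, (5.10) p.293, §1 pp.263-264 and §5 p.298] -/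
theorem stabilityBRunRowsAtRecordR13SepCoPHV_of_ceilingKeyedRung1VWithMassBandCornerLetters
    (hprod : ∀ F : T4Family, Inhabited13 F →
      ∃ (θ : Node00.Stage13HParams F 2) (h : θ.Provisos₁₃SepCoPH F 2) (v : Node00.Revision₁₃ F 2 θ h), (θ.ZhUnity F 2 ∧ θ.SlotsNondegenerate₁₃ F 2) ∧ θ.Admissible F 2 ∧
        (∀ c : ℝ, ∃ w : WorldP, c ≤ w.βup ∧ RecordSV F θ h v w ∧ ∀ P : B12.RunParams, Nodes (leavesP w P)) ∧
        (∃ (Λ : ℕ → ℕ → ℝ) (M : ℝ), HistLipschitz Λ θ.γ (Node00.betaOfRecord₁₃ F 2 θ.toStage13Params) ∧ ∀ k, ∑ i : Fin (k + 1), |Λ k i| ≤ M) ∧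
        ∃ (b : ℕ → ℝ) (s A : ℝ), ScaleAnchor (Node00.betaOfRecord₁₃ F 2 θ.toStage13Params) b ∧ 0 < s ∧ OneLoopDrift s A b) :
    StabilityBRunRowsAtRecordR13SepCoPHV :=
  stabilityBRunRowsAtRecordR13SepCoPHV_of_rung0_runRowsContV fun F hinh => by
    obtain ⟨θ, hP, v, hU, hθ, hfam, ⟨Λ, M, hL, hM⟩, b, s, A, hb, hs, hdrift⟩ := hprod F hinh
    exact runRowsContAtSomeRecord13PWSV_of_ceilingKeyedRung1V_cornerLetters θ hP v hU hθ hfam hL hM hb hs hdrift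

/-- **… WITH A PINNED `RecordSV` WORLD (any slack `s + 2A < w.βup`)** — the LINE-2 twin of p626226 :93 ∕ p622247 :214.  CONDITIONAL; K1⁹ NOT closed; nothing of Bałaban asserted.
[cite: Balaban1989LargeFieldII, Thm 1 p.355 and (0.1) pp.355-356; Balaban1987RG1, (0.20) p.256, Thm 2 p.259 (first sentence), Thm 3 p.264, (2.12)-(2.14) p.268, (5.10) p.293, §1 pp.263-264] -/
theorem stabilityBRunRowsAtRecordR13SepCoPHV_of_rung1VWithMassBandCornerLetters
    (hprod : ∀ F : T4Family, Inhabited13 F →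
      ∃ (θ : Node00.Stage13HParams F 2) (h : θ.Provisos₁₃SepCoPH F 2) (v : Node00.Revision₁₃ F 2 θ h), (θ.ZhUnity F 2 ∧ θ.SlotsNondegenerate₁₃ F 2) ∧ θ.Admissible F 2 ∧
        (∃ (Λ : ℕ → ℕ → ℝ) (M : ℝ), HistLipschitz Λ θ.γ (Node00.betaOfRecord₁₃ F 2 θ.toStage13Params) ∧ ∀ k, ∑ i : Fin (k + 1), |Λ k i| ≤ M) ∧
        ∃ (b : ℕ → ℝ) (s A : ℝ), ScaleAnchor (Node00.betaOfRecord₁₃ F 2 θ.toStage13Params) b ∧ 0 < s ∧ OneLoopDrift s A b ∧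
          ∃ w : WorldP, s + 2 * A < w.βup ∧ RecordSV F θ h v w ∧ ∀ P : B12.RunParams, Nodes (leavesP w P)) :
    StabilityBRunRowsAtRecordR13SepCoPHV :=
  stabilityBRunRowsAtRecordR13SepCoPHV_of_rung0_runRowsContV fun F hinh => by
    obtain ⟨θ, hP, v, hU, hθ, ⟨Λ, M, hL, hM⟩, b, s, A, hb, hs, hdrift, w, hmatch, hRV, hnodes⟩ := hprod F hinh
    exact runRowsContAtSomeRecord13PWSV_of_rung1VAt_cornerLetters_lt θ hP v w hU hθ hRV hnodes hL hM hb hs hdrift hmatch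

/-- **★ K1⁹ BY NAME FROM A CEILING-KEYED STUB-1ⱽ-SHAPED TEXT AND THE TWO ∀θ CORNER LETTERS** (the LINE-2 twin of p626226 :310 — on LINE 2 the letters are keyed on provisos, unity∧slots and
admissibility ALONE): (a) «∀ F, Inhabited13 F → SOME unity admissible `(θ, h)`, SOME slot `v`, and above EVERY ceiling an `RecordSV` world of the revised datum with the thirteen nodes» (a
stub-1ⱽ text in the N11CU currency; the pins are not needed by the road and not asked), (b) U3ᴷ-lite(θ), (c) anchor + positive drift(θ) ⟹ `…Theses.BalabanUVNodes.StabilityBRunRowsAtRecordR13SepCoPHV`.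
So on LINE 2 the corner road owes K1⁹ exactly {(b), (c)} on the β side and {(a)} on the world side — (B)ⱽ and the window are OUTPUTS.  CONDITIONAL on three displayed texts (none supplied here);
K1⁹ NOT closed; nothing of Bałaban asserted; no count moved.
[cite: Balaban1988Convergent, Thm 1 p.262; Balaban1989LargeFieldII, Thm 1 p.355 and (0.1) pp.355-356; Balaban1987RG1, (0.20) p.256, Thm 2 p.259 (first sentence), Thm 3 p.264, (2.12)-(2.14) p.268, (5.10) p.293, §1 pp.263-264 and §5 p.298] -/
theorem stabilityBRunRowsAtRecordR13SepCoPHV_of_ceilRung1VText_liteText_cornerText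
    (h1C : ∀ F : T4Family, Inhabited13 F →
      ∃ (θ : Node00.Stage13HParams F 2) (h : θ.Provisos₁₃SepCoPH F 2) (v : Node00.Revision₁₃ F 2 θ h), (θ.ZhUnity F 2 ∧ θ.SlotsNondegenerate₁₃ F 2) ∧ θ.Admissible F 2 ∧
        ∀ c : ℝ, ∃ w : WorldP, c ≤ w.βup ∧ RecordSV F θ h v w ∧ ∀ P : B12.RunParams, Nodes (leavesP w P))
    (hLite : ∀ (F : T4Family) (θ : Node00.Stage13HParams F 2), θ.Provisos₁₃SepCoPH F 2 → (θ.ZhUnity F 2 ∧ θ.SlotsNondegenerate₁₃ F 2) → θ.Admissible F 2 →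
      ∃ (Λ : ℕ → ℕ → ℝ) (M : ℝ), HistLipschitz Λ θ.γ (Node00.betaOfRecord₁₃ F 2 θ.toStage13Params) ∧ ∀ k, ∑ i : Fin (k + 1), |Λ k i| ≤ M)
    (hCD : ∀ (F : T4Family) (θ : Node00.Stage13HParams F 2), θ.Provisos₁₃SepCoPH F 2 → (θ.ZhUnity F 2 ∧ θ.SlotsNondegenerate₁₃ F 2) → θ.Admissible F 2 →
      ∃ (b : ℕ → ℝ) (s A : ℝ), ScaleAnchor (Node00.betaOfRecord₁₃ F 2 θ.toStage13Params) b ∧ 0 < s ∧ OneLoopDrift s A b) :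
    StabilityBRunRowsAtRecordR13SepCoPHV :=
  stabilityBRunRowsAtRecordR13SepCoPHV_of_ceilingKeyedRung1VWithMassBandCornerLetters fun F hinh => by
    obtain ⟨θ, hP, v, hU, hθ, hfam⟩ := h1C F hinh
    exact ⟨θ, hP, v, hU, hθ, hfam, hLite F θ hP hU hθ, hCD F θ hP hU hθ⟩

/-- **★★ K1⁹ BY NAME FROM THE REGISTERED STUB 1ⱽ TEXT + THE CEILING LIFT + THE TWO ∀θ CORNER LETTERS**: `h₁` IS the registered `stub_nodes13PWSV` signature (`∀ F, Inhabited13 F → NodesAtSomeRecord13PWSV F`,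
`K1V9Defs` names), so a sorry-free proof of stub 1ⱽ (the N13 ∕ engine lanes' XL piece) together with INHABITANTS of (a) the ceiling lift on rung-1ⱽ worlds, (b) U3ᴷ-lite and (c) the anchored
positive drift closes the DECIDING crux through this theorem — stubs 2ⱽ and 3ⱽ being then §2's ★ (`K1V9Defs.stabilityBRunRowsAtRecordR13SepCoPHV_of_rung0_runRowsContV` ∘
`stub_runRowsCont13VText_of_ceilingLiftV_liteText_cornerText`).  CONDITIONAL on four displayed texts (none supplied here); K1⁹ NOT closed; no stub proved; nothing of Bałaban asserted; no count moved.
[cite: Balaban1988Convergent, Thm 1 p.262, Cor. 3 (2.50) p.264; Balaban1989LargeFieldII, Thm 1 p.355 and (0.1) pp.355-356; Balaban1987RG1, (0.20) p.256, Thm 2 p.259 (first sentence), Thm 3 p.264, (2.12)-(2.14) p.268, (5.10) p.293, §1 pp.263-264 and §5 p.298] -/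
theorem stabilityBRunRowsAtRecordR13SepCoPHV_of_stub1VText_ceilingLiftV_liteText_cornerText
    (h₁ : ∀ F : T4Family, Inhabited13 F → NodesAtSomeRecord13PWSV F)
    (hLift : ∀ (F : T4Family) (θ : Node00.Stage13HParams F 2) (h : θ.Provisos₁₃SepCoPH F 2) (v : Node00.Revision₁₃ F 2 θ h) (w : WorldP),
      (θ.ZhUnity F 2 ∧ θ.SlotsNondegenerate₁₃ F 2) → θ.Admissible F 2 → RecordSV F θ h v w → (∀ P : B12.RunParams, Nodes (leavesP w P)) →
      ∀ c : ℝ, ∃ w' : WorldP, c ≤ w'.βup ∧ RecordSV F θ h v w' ∧ ∀ P : B12.RunParams, Nodes (leavesP w' P))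
    (hLite : ∀ (F : T4Family) (θ : Node00.Stage13HParams F 2), θ.Provisos₁₃SepCoPH F 2 → (θ.ZhUnity F 2 ∧ θ.SlotsNondegenerate₁₃ F 2) → θ.Admissible F 2 →
      ∃ (Λ : ℕ → ℕ → ℝ) (M : ℝ), HistLipschitz Λ θ.γ (Node00.betaOfRecord₁₃ F 2 θ.toStage13Params) ∧ ∀ k, ∑ i : Fin (k + 1), |Λ k i| ≤ M)
    (hCD : ∀ (F : T4Family) (θ : Node00.Stage13HParams F 2), θ.Provisos₁₃SepCoPH F 2 → (θ.ZhUnity F 2 ∧ θ.SlotsNondegenerate₁₃ F 2) → θ.Admissible F 2 →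
      ∃ (b : ℕ → ℝ) (s A : ℝ), ScaleAnchor (Node00.betaOfRecord₁₃ F 2 θ.toStage13Params) b ∧ 0 < s ∧ OneLoopDrift s A b) :
    StabilityBRunRowsAtRecordR13SepCoPHV :=
  stabilityBRunRowsAtRecordR13SepCoPHV_of_rung0_runRowsContV fun F hinh =>
    stub_runRowsCont13VText_of_ceilingLiftV_liteText_cornerText hLift hLite hCD F (h₁ F hinh)

/-- **★★ THE SAME, PRESENTED THROUGH THE THREE REGISTERED V-STUB SIGNATURES** (DEF-1's `K1V9Defs.stabilityBRunRowsAtRecordR13SepCoPHV_of_stubTextsV` = plan g86's `k1R9_of_stubsV` over the tree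
names): `h₁` = `stub_nodes13PWSV`'s text (given), `h₂` = `stub_runRows13PWSV`'s text from the ceiling lift + U3ᴷ-lite + the anchored positive drift (§2), `h₃` = `stub_cont13V`'s text from U3ᴷ-lite's
MODULI ALONE (§2 `stub_cont13VText_of_histModuliU`).  This is the LINE-2 ledger of the corner road: stub 2ⱽ ⟸ {lift, moduli-with-mass, anchor, positive drift}; stub 3ⱽ ⟸ {moduli}.  CONDITIONAL on
four displayed texts (none supplied here); K1⁹ NOT closed; no stub proved; nothing of Bałaban asserted; no count moved.
[cite: Balaban1988Convergent, Thm 1 p.262, Cor. 3 (2.50) p.264; Balaban1989LargeFieldII, Thm 1 p.355 and (0.1) pp.355-356; Balaban1987RG1, (0.20) p.256, Thm 2 p.259 (first sentence), Thm 3 p.264, (2.12)-(2.14) p.268, (5.10) p.293, §1 pp.263-264 and §5 p.298] -/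
theorem stabilityBRunRowsAtRecordR13SepCoPHV_of_stubTextsV_cornerRoad
    (h₁ : ∀ F : T4Family, Inhabited13 F → NodesAtSomeRecord13PWSV F)
    (hLift : ∀ (F : T4Family) (θ : Node00.Stage13HParams F 2) (h : θ.Provisos₁₃SepCoPH F 2) (v : Node00.Revision₁₃ F 2 θ h) (w : WorldP),
      (θ.ZhUnity F 2 ∧ θ.SlotsNondegenerate₁₃ F 2) → θ.Admissible F 2 → RecordSV F θ h v w → (∀ P : B12.RunParams, Nodes (leavesP w P)) →
      ∀ c : ℝ, ∃ w' : WorldP, c ≤ w'.βup ∧ RecordSV F θ h v w' ∧ ∀ P : B12.RunParams, Nodes (leavesP w' P))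
    (hLite : ∀ (F : T4Family) (θ : Node00.Stage13HParams F 2), θ.Provisos₁₃SepCoPH F 2 → (θ.ZhUnity F 2 ∧ θ.SlotsNondegenerate₁₃ F 2) → θ.Admissible F 2 →
      ∃ (Λ : ℕ → ℕ → ℝ) (M : ℝ), HistLipschitz Λ θ.γ (Node00.betaOfRecord₁₃ F 2 θ.toStage13Params) ∧ ∀ k, ∑ i : Fin (k + 1), |Λ k i| ≤ M)
    (hCD : ∀ (F : T4Family) (θ : Node00.Stage13HParams F 2), θ.Provisos₁₃SepCoPH F 2 → (θ.ZhUnity F 2 ∧ θ.SlotsNondegenerate₁₃ F 2) → θ.Admissible F 2 →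
      ∃ (b : ℕ → ℝ) (s A : ℝ), ScaleAnchor (Node00.betaOfRecord₁₃ F 2 θ.toStage13Params) b ∧ 0 < s ∧ OneLoopDrift s A b) :
    StabilityBRunRowsAtRecordR13SepCoPHV :=
  stabilityBRunRowsAtRecordR13SepCoPHV_of_stubTextsV h₁ (stub_runRows13PWSVText_of_ceilingLiftV_liteText_cornerText hLift hLite hCD)
    (stub_cont13VText_of_histModuliU fun F θ hP hU hθ => by
      obtain ⟨Λ, -, hL, -⟩ := hLite F θ hP hU hθ
      exact ⟨Λ, hL⟩)

/-- **★★ K1⁹ BY NAME FROM THE REGISTERED STUB 1ⱽ TEXT + N11CU AT THE SLOT WORLD + THE TWO ∀θ CORNER LETTERS** (the ceiling lift of `…_of_stubTextsV_cornerRoad` DISCHARGED down to one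
node by §2b): stub 2ⱽ ⟸ {N11 ceiling-uniform at rung-1ⱽ core data, U3ᴷ-lite, anchor + positive drift}; stub 3ⱽ ⟸ {U3ᴷ-lite's moduli}.  CONDITIONAL on four displayed texts (none supplied
here); K1⁹ NOT closed; no stub proved; nothing of Bałaban asserted; no count moved.
[cite: Balaban1988Convergent, Thm 1 p.262, (2.6) p.255, Cor. 3 (2.50) p.264; Balaban1989LargeFieldII, Thm 1 p.355 and (0.1) pp.355-356; Balaban1987RG1, (0.20) p.256, Thm 2 p.259 (first sentence), Thm 3 p.264, (2.12)-(2.14) p.268, (5.10) p.293, §1 pp.263-264 and §5 p.298] -/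
theorem stabilityBRunRowsAtRecordR13SepCoPHV_of_stub1VText_n11CUV_liteText_cornerText
    (h₁ : ∀ F : T4Family, Inhabited13 F → NodesAtSomeRecord13PWSV F)
    (hN11V : ∀ (F : T4Family) (θ : Node00.Stage13HParams F 2) (h : θ.Provisos₁₃SepCoPH F 2) (v : Node00.Revision₁₃ F 2 θ h) (w : WorldP),
      (θ.ZhUnity F 2 ∧ θ.SlotsNondegenerate₁₃ F 2) → θ.Admissible F 2 → RecordSV F θ h v w → (∀ P : B12.RunParams, Nodes (leavesP w P)) →
      ∀ c : ℝ, ∃ γ' : ℝ, 0 < γ' ∧ γ' ≤ w.γ ∧ ∀ P : B12.RunParams, Dag.B14_main (leavesP { w with βup := c, γ := γ' } P))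
    (hLite : ∀ (F : T4Family) (θ : Node00.Stage13HParams F 2), θ.Provisos₁₃SepCoPH F 2 → (θ.ZhUnity F 2 ∧ θ.SlotsNondegenerate₁₃ F 2) → θ.Admissible F 2 →
      ∃ (Λ : ℕ → ℕ → ℝ) (M : ℝ), HistLipschitz Λ θ.γ (Node00.betaOfRecord₁₃ F 2 θ.toStage13Params) ∧ ∀ k, ∑ i : Fin (k + 1), |Λ k i| ≤ M)
    (hCD : ∀ (F : T4Family) (θ : Node00.Stage13HParams F 2), θ.Provisos₁₃SepCoPH F 2 → (θ.ZhUnity F 2 ∧ θ.SlotsNondegenerate₁₃ F 2) → θ.Admissible F 2 →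
      ∃ (b : ℕ → ℝ) (s A : ℝ), ScaleAnchor (Node00.betaOfRecord₁₃ F 2 θ.toStage13Params) b ∧ 0 < s ∧ OneLoopDrift s A b) :
    StabilityBRunRowsAtRecordR13SepCoPHV :=
  stabilityBRunRowsAtRecordR13SepCoPHV_of_stubTextsV_cornerRoad h₁
    (fun F θ h v w hU hθ hR hnodes => ceilingKeyedRung1V_of_nodes_of_b14Raise θ h v w hR hnodes (hN11V F θ h v w hU hθ hR hnodes)) hLite hCD

end Witness

end Summit.QuantumFields.YangMills.Theorems.BalabanUVNodesK2CornerRoadLine2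

end
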